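import Summits.ResolutionOfSingularities.ResolutionOfSingularities.Theorems.PurelyInseparableDim4DirectrixTwo
import Summits.ResolutionOfSingularities.ResolutionOfSingularities.Theorems.PurelyInseparableDim4FreeTail
import HarnessLib

/-!
# [OURS · res-dim4-pi «F4-I(3,3) BEYOND MILNOR-FINITE», brick (i-b)] The ORDER DICHOTOMY of isolated chains:
  the high-order states form an INITIAL SEGMENT; F4-I(3,3) splits into the BAND half (K2) and the
  TANGENT-CONE half (ord ≡ 3)

Cell `res-dim4-pi` (D-0157 DOOR 2), desk WORD #35 (b) (seat `res-dim4-p-5`). Def-free assembly of three tree facts: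
IB-1 (`IsolatedBand.isolated_chain_band`: along an isolated `Step0 q` chain `q ≤ ord₀ F ≤ 2q − 2`), p-12's
DIRECTRIX DICTIONARY (`Directrix.step0_chain_ordZero_eq`: from a state with `ord₀ F = p` and `∇F_p ≠ 0` the order
stays `p` for ever; `Directrix.gradSpan_initialForm_ne_bot_of_isClean`, `Directrix.isClean_step`: from index `1` every state
is clean, and a clean state of order `p` has `∇F_p ≠ 0`), and idea-7/typ-1's band statement `FreeTail.NoIsolatedBandRun3`.

## What is proved (every prime `p`; `(3,3)` instances named)
* §1 `isClean_of_step0`, **`ordZero_eq_of_le`** — along a `Step0 p` chain, if some state of index `k₀ ≥ 1` has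
  `ord₀ F = p` then EVERY later state has `ord₀ F = p`: the states of order `> p` form an INITIAL SEGMENT.
* §2 **`isolated_chain_order_dichotomy_three`** — an isolated `Step0 3` chain either has `ord₀ F_k = 4` for all
  `k ≥ 1`, or has `ord₀ F_k = 3` for all `k` from some index on.
* §3 **`noIsolatedTrap_three_three_of_band_and_cone`** — `NoIsolatedTrap 3 3 ⟸ NoIsolatedBandRun3` (K2 =
  free-tail lemma + SH3, card I-7-2) `∧` «no infinite isolated `Step0 3` chain all of whose states have `ord₀ F = 3`»
  (the TANGENT-CONE half: there `ē ≤ 2` and, over fields of characteristic `3 ≥ dim X/2 + 1`, the printed CJS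
  termination theorems are the candidate — modulo the frame ↔ CJS dictionary; NOT proved here).

[OURS · counted 0 · AI work weaker than expert review] Nothing here proves `NoIsolatedTrap 3 3` or resolution of
singularities in dimension ≥ 4 / characteristic `p`; a reduction inside OUR frame.
bears_on: LADDER-RESOLUTION:D157-DOOR2 (res-dim4-pi · F4-I(3,3) (i-b)). Supports stmt-ResolutionOfSingularities-16155
(helper).
-/

set_option linter.dupNamespace false -- mandated namespace of this single-conjunct summit

noncomputable section

namespace Summit.ResolutionOfSingularities.ResolutionOfSingularities.Theorems.PIDim4

namespace IsolatedBand

open MvPolynomial Finset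
open Literature.AlgebraicGeometry.Resolution
open Literature.AlgebraicGeometry.Resolution.Hauser2010
open Literature.Barriers.ResolutionOfSingularities

variable {K : Type} [Field K]

/-! ## §1 Along a `Step0` chain the order-`> p` states form an initial segment -/

/-- Every state of a `Step0` chain after the first is clean. [folklore] -/
theorem isClean_of_step0 [DecidableEq K] {q : ℕ} {s s' : State K} (h : Step0 q s s') :
    HauserPerlega.IsClean q s'.F := by
  obtain ⟨-, j, b, -, -, -, -, rfl⟩ := h
  exact Directrix.isClean_step q Finset.univ j b s

/-- **Order `p` is absorbing.** Along a `Step0 p` chain (`p` prime, characteristic `p`): if the state of some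
index `k₀ ≥ 1` has `ord₀ F = p`, then so does every later state (clean + order `p` ⇒ `∇F_p ≠ 0`, p-12; then
`Directrix.step0_chain_ordZero_eq` on the shifted chain). [folklore] -/
theorem ordZero_eq_of_le (p : ℕ) [Fact p.Prime] [CharP K p] [DecidableEq K] {c : ℕ → State K}
    (hc : ∀ k, Step0 p (c k) (c (k + 1))) {k₀ : ℕ} (hk₀ : 1 ≤ k₀) (hord : ordZero (c k₀).F = p)
    {k : ℕ} (hk : k₀ ≤ k) : ordZero (c k).F = p := by
  have hclean : HauserPerlega.IsClean p (c k₀).F := by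
    obtain ⟨m, rfl⟩ : ∃ m, k₀ = m + 1 := ⟨k₀ - 1, by omega⟩
    exact isClean_of_step0 (hc m)
  have hgrad := Directrix.gradSpan_initialForm_ne_bot_of_isClean p hord hclean
  obtain ⟨m, rfl⟩ := Nat.exists_eq_add_of_le hk
  have h := Directrix.step0_chain_ordZero_eq p (fun i => c (k₀ + i)) (fun i => hc (k₀ + i)) hord hgrad m
  exact h.1

/-! ## §2 `(3,3)`: band for ever, or tangent cone from some index on -/

/-- **The order dichotomy at `(3,3)`.** Along an isolated `Step0 3` chain over a field of characteristic `3`,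
EITHER every state of index `≥ 1` has `ord₀ F = 4` (an all-band chain), OR from some index on every state has
`ord₀ F = 3`. [folklore] -/
theorem isolated_chain_order_dichotomy_three [CharP K 3] [DecidableEq K] {c : ℕ → State K}
    (hc : ∀ k, IsIsolated 3 (c k).F ∧ Step0 3 (c k) (c (k + 1))) :
    (∀ k, 1 ≤ k → ordZero (c k).F = (4 : ℕ∞)) ∨
      ∃ k₀, ∀ k, k₀ ≤ k → ordZero (c k).F = (3 : ℕ∞) := by
  haveI : Fact (Nat.Prime 3) := ⟨Nat.prime_three⟩
  by_cases h : ∃ k₀, 1 ≤ k₀ ∧ ordZero (c k₀).F = (3 : ℕ∞)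
  · obtain ⟨k₀, hk₀, hord⟩ := h
    refine Or.inr ⟨k₀, fun k hk => ?_⟩
    exact_mod_cast ordZero_eq_of_le 3 (fun k => (hc k).2) hk₀ (by exact_mod_cast hord) hk
  · push Not at h
    refine Or.inl fun k hk => ?_
    obtain ⟨h3, h4⟩ := isolated_chain_band (by norm_num : 2 ≤ 3) hc k
    -- `3 ≤ ord ≤ 4` and `ord ≠ 3`
    have hne : ordZero (c k).F ≠ ((3 : ℕ) : ℕ∞) := by
      have := h k hk
      rwa [show (3 : ℕ∞) = ((3 : ℕ) : ℕ∞) from (Nat.cast_ofNat).symm] at this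
    have hfin : ordZero (c k).F ≠ ⊤ := ne_top_of_le_ne_top (ENat.coe_ne_top _) h4
    obtain ⟨o, ho⟩ := ENat.ne_top_iff_exists.mp hfin
    rw [← ho] at h4 h3 hne ⊢
    have h4n : o ≤ 2 * 3 - 2 := by exact_mod_cast h4
    have h3n : 3 ≤ o := by exact_mod_cast h3
    have hne3 : o ≠ 3 := fun hh => hne (by rw [hh])
    have ho4 : o = 4 := by omega
    rw [ho4]
    exact Nat.cast_ofNat

/-! ## §3 F4-I(3,3) = BAND half + TANGENT-CONE half -/

/-- **`NoIsolatedTrap 3 3` from the two halves.** If (K2) no infinite isolated all-band chain exists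
(`FreeTail.NoIsolatedBandRun3`, = free-tail lemma + SH3 by `FreeTail.noIsolatedBandRun3_of_charP`) and no
infinite isolated `Step0 3` chain has ALL states of order `3` (the tangent-cone regime, `ē ≤ 2`), then F4-I(3,3)
holds: by §2 every isolated chain has a tail of one of the two kinds. [folklore] -/
theorem noIsolatedTrap_three_three_of_band_and_cone (hband : FreeTail.NoIsolatedBandRun3)
    (hcone : ∀ (K : Type) [Field K] [CharP K 3] [DecidableEq K],
      ¬ ∃ c : ℕ → State K, ∀ k, IsIsolated 3 (c k).F ∧ Step0 3 (c k) (c (k + 1)) ∧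
        ordZero (c k).F = (3 : ℕ∞)) :
    NoIsolatedTrap 3 3 := by
  intro K _ _ _
  rintro ⟨c, hc⟩
  rcases isolated_chain_order_dichotomy_three hc with hall | ⟨k₀, htail⟩
  · exact hband K ⟨fun k => c (k + 1), fun k => ⟨(hc (k + 1)).1, (hc (k + 1)).2, hall (k + 1) (by omega)⟩⟩
  · exact hcone K ⟨fun k => c (k₀ + k), fun k =>
      ⟨(hc (k₀ + k)).1, (hc (k₀ + k)).2, htail (k₀ + k) (Nat.le_add_right _ _)⟩⟩

/-- Conversely the two halves are special cases of `NoIsolatedTrap 3 3` (so §3 is an exact splitting).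
[folklore] -/
theorem band_and_cone_of_noIsolatedTrap_three_three (h : NoIsolatedTrap 3 3) :
    FreeTail.NoIsolatedBandRun3 ∧
      ∀ (K : Type) [Field K] [CharP K 3] [DecidableEq K],
        ¬ ∃ c : ℕ → State K, ∀ k, IsIsolated 3 (c k).F ∧ Step0 3 (c k) (c (k + 1)) ∧
          ordZero (c k).F = (3 : ℕ∞) := by
  refine ⟨fun K _ _ _ => ?_, fun K _ _ _ => ?_⟩
  · rintro ⟨c, hc⟩
    exact h K ⟨c, fun k => ⟨(hc k).1, (hc k).2.1⟩⟩
  · rintro ⟨c, hc⟩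
    exact h K ⟨c, fun k => ⟨(hc k).1, (hc k).2.1⟩⟩

end IsolatedBand

end Summit.ResolutionOfSingularities.ResolutionOfSingularities.Theorems.PIDim4

end
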